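import Summits.BirchSwinnertonDyer.BirchSwinnertonDyer.Theorems.ManinLocalTwoThreeShiftClosureDelta
import Summits.BirchSwinnertonDyer.BirchSwinnertonDyer.Theorems.ManinLocalTwoThreeShiftInvariantHeckeEigenvalue
import Literature.NumberTheory.EllipticCurves.Gamma0CocycleDegeneracyMaps
import HarnessLib

/-!
# E-es-38 `OddShiftReduction`, part 1/3: the shift relation `Y = diag(s,1) X diag(s,1)⁻¹` in `SL₂`, `t`-adic depth
# `Γ(t^M)`, `tⁿ`-shift invariance on entries, and conjugation by `diag(t, t⁻¹)` as the `t²`-shift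

Summit `BirchSwinnertonDyer`, route `ManinLocalTwoThree` (cell bsd-f2-manin), deciding crux C2 `ManinOddAtFour`
(stmt-BirchSwinnertonDyer-22967), skeleton `kato_shift_two` v6, stub 3 `stub_cThreeImageResidual` (the `C₃`-image residual).
The es planner's line for that stub (MEMO-es §25, HOME/es/Sketch-es-g12.lean) needs the reduction (N) **E-es-38
`EsG12.OddShiftReduction`**: for ODD `n = 2m+1`, `tⁿ`-shift invariance of a generalised Hecke eigen-homomorphism with hNT(`t`)
implies `t`-shift invariance.  Mechanism (§25.3 (N)): `diag(t,1) = diag(t,1)ⁿ · (t · diag(t,t⁻¹))^{−m}` and `diag(t,t⁻¹) ∈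
Δ_t(L′) ⊆ ⟨ιΓ₀(L), shifts⟩` (LEMMA G, p1 `delta_le_of_gamma0Image_le_of_shiftStable`), so `π_t^*u − π_1^*u` kills a deep
`t`-congruence subgroup, hence vanishes by LEMMA C (p604131) + hNT.  This file is the entry-level plumbing, all def-free:
the shift relation on entries (`shiftRel_mul/inv/trans/unique/unique'/one`), `t`-adic depth (`mem_Gamma_iff_dvd`,
`Gamma_pow_le`, `mem_Gamma_of_shiftRel{,'}`, `exists_shiftRel_down/up`, `shiftRel_iota{,_pow}`), the entry form of
`tⁿ`-shift invariance (`apply_eq_of_shiftInvariant`), and `shiftRel_diagP{,_pow}_conj`, `diagP_mem_Delta`.  Parts 2/3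
(`…ShiftConjugationInvariance.lean`: the GOOD-subgroup and LEMMA G) and 3/3 (`…OddShiftReduction.lean`) follow.  No new
definitions; nothing about BSD or Manin's conjecture is proved here.  References: HOME/MEMO-es.md §25.3 (N); J.-P. Serre,
*Trees*, II.1.4 (the `S`-arithmetic group `SL₂(ℤ[1/t])`).
-/

set_option autoImplicit false
set_option linter.dupNamespace false

open scoped MatrixGroups

open CongruenceSubgroup Matrix.SpecialLinearGroup Literature.NumberTheory.EllipticCurves.ModularForms
  Literature.NumberTheory.EllipticCurves.ModularForms.HidaCohomology
  Summit.BirchSwinnertonDyer.BirchSwinnertonDyer.Theorems.ConjSpanGenAllLevels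

namespace Summit.BirchSwinnertonDyer.BirchSwinnertonDyer.Theorems.ManinLocalTwoThree

/-! ### The shift relation `Y = diag(s,1) X diag(s,1)⁻¹` inside `SL₂(A)`, written on entries -/

section ShiftRel

variable {A : Type*} [CommRing A] (s : A)

/-- The shift relation is multiplicative. [folklore] -/
theorem shiftRel_mul {X X' Y Y' : SL(2, A)}
    (hX : X' 0 0 = X 0 0 ∧ X' 0 1 = s * X 0 1 ∧ s * X' 1 0 = X 1 0 ∧ X' 1 1 = X 1 1)
    (hY : Y' 0 0 = Y 0 0 ∧ Y' 0 1 = s * Y 0 1 ∧ s * Y' 1 0 = Y 1 0 ∧ Y' 1 1 = Y 1 1) :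
    (X' * Y') 0 0 = (X * Y) 0 0 ∧ (X' * Y') 0 1 = s * (X * Y) 0 1 ∧ s * (X' * Y') 1 0 = (X * Y) 1 0 ∧
      (X' * Y') 1 1 = (X * Y) 1 1 := by
  obtain ⟨h1, h2, h3, h4⟩ := hX
  obtain ⟨k1, k2, k3, k4⟩ := hY
  simp only [coe_mul, Matrix.mul_apply, Fin.sum_univ_two]
  refine ⟨?_, ?_, ?_, ?_⟩
  · linear_combination (Y' 0 0) * h1 + (X 0 0) * k1 + (Y' 1 0) * h2 + (X 0 1) * k3
  · linear_combination (Y' 0 1) * h1 + (X 0 0) * k2 + (Y' 1 1) * h2 + s * (X 0 1) * k4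
  · linear_combination (Y' 0 0) * h3 + (X 1 0) * k1 + s * (Y' 1 0) * h4 + (X 1 1) * k3
  · linear_combination (X' 1 0) * k2 + (Y 0 1) * h3 + (Y' 1 1) * h4 + (X 1 1) * k4

/-- The shift relation passes to inverses. [folklore] -/
theorem shiftRel_inv {X X' : SL(2, A)}
    (hX : X' 0 0 = X 0 0 ∧ X' 0 1 = s * X 0 1 ∧ s * X' 1 0 = X 1 0 ∧ X' 1 1 = X 1 1) :
    (X'⁻¹) 0 0 = (X⁻¹) 0 0 ∧ (X'⁻¹) 0 1 = s * (X⁻¹) 0 1 ∧ s * (X'⁻¹) 1 0 = (X⁻¹) 1 0 ∧ (X'⁻¹) 1 1 = (X⁻¹) 1 1 := by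
  obtain ⟨h1, h2, h3, h4⟩ := hX
  simp only [coe_inv, Matrix.adjugate_fin_two, Matrix.of_apply, Matrix.cons_val', Matrix.cons_val_zero,
    Matrix.cons_val_one, Matrix.empty_val', Matrix.cons_val_fin_one]
  refine ⟨h4, ?_, ?_, h1⟩
  · rw [h2]; ring
  · rw [← h3]; ring

/-- The shift relation is transitive with product of scalars. [folklore] -/
theorem shiftRel_trans {s₁ s₂ : A} {X Y Z : SL(2, A)}
    (hXY : Y 0 0 = X 0 0 ∧ Y 0 1 = s₁ * X 0 1 ∧ s₁ * Y 1 0 = X 1 0 ∧ Y 1 1 = X 1 1)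
    (hYZ : Z 0 0 = Y 0 0 ∧ Z 0 1 = s₂ * Y 0 1 ∧ s₂ * Z 1 0 = Y 1 0 ∧ Z 1 1 = Y 1 1) :
    Z 0 0 = X 0 0 ∧ Z 0 1 = (s₁ * s₂) * X 0 1 ∧ (s₁ * s₂) * Z 1 0 = X 1 0 ∧ Z 1 1 = X 1 1 := by
  obtain ⟨h1, h2, h3, h4⟩ := hXY
  obtain ⟨k1, k2, k3, k4⟩ := hYZ
  refine ⟨k1.trans h1, ?_, ?_, k4.trans h4⟩
  · rw [k2, h2]; ring
  · rw [← h3, ← k3]; ring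

/-- The shifted element is unique when the scalar is a unit. [folklore] -/
theorem shiftRel_unique (hs : IsUnit s) {X Y Z : SL(2, A)}
    (hY : Y 0 0 = X 0 0 ∧ Y 0 1 = s * X 0 1 ∧ s * Y 1 0 = X 1 0 ∧ Y 1 1 = X 1 1)
    (hZ : Z 0 0 = X 0 0 ∧ Z 0 1 = s * X 0 1 ∧ s * Z 1 0 = X 1 0 ∧ Z 1 1 = X 1 1) : Y = Z := by
  obtain ⟨h1, h2, h3, h4⟩ := hY
  obtain ⟨k1, k2, k3, k4⟩ := hZ
  ext i j
  fin_cases i <;> fin_cases j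
  · exact h1.trans k1.symm
  · exact h2.trans k2.symm
  · exact hs.mul_left_cancel (h3.trans k3.symm)
  · exact h4.trans k4.symm

/-- The element of which a given one is the shift is unique when the scalar is a unit. [folklore] -/
theorem shiftRel_unique' (hs : IsUnit s) {X Y Z : SL(2, A)}
    (hX : Z 0 0 = X 0 0 ∧ Z 0 1 = s * X 0 1 ∧ s * Z 1 0 = X 1 0 ∧ Z 1 1 = X 1 1)
    (hY : Z 0 0 = Y 0 0 ∧ Z 0 1 = s * Y 0 1 ∧ s * Z 1 0 = Y 1 0 ∧ Z 1 1 = Y 1 1) : X = Y := by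
  obtain ⟨h1, h2, h3, h4⟩ := hX
  obtain ⟨k1, k2, k3, k4⟩ := hY
  ext i j
  fin_cases i <;> fin_cases j
  · exact h1.symm.trans k1
  · exact hs.mul_left_cancel (h2.symm.trans k2)
  · exact h3.symm.trans k3
  · exact h4.symm.trans k4

/-- The identity is its own shift. [folklore] -/
theorem shiftRel_one : (1 : SL(2, A)) 0 0 = (1 : SL(2, A)) 0 0 ∧ (1 : SL(2, A)) 0 1 = s * (1 : SL(2, A)) 0 1 ∧
    s * (1 : SL(2, A)) 1 0 = (1 : SL(2, A)) 1 0 ∧ (1 : SL(2, A)) 1 1 = (1 : SL(2, A)) 1 1 := by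
  simp

end ShiftRel

/-! ### `t`-adic depth: membership in the principal congruence subgroup `Γ(t^M)` -/

section Depth

/-- Membership in `Γ(N)` as four divisibilities. [folklore] -/
theorem mem_Gamma_iff_dvd (N : ℕ) (γ : SL(2, ℤ)) :
    γ ∈ Gamma N ↔ (N : ℤ) ∣ γ 0 0 - 1 ∧ (N : ℤ) ∣ γ 0 1 ∧ (N : ℤ) ∣ γ 1 0 ∧ (N : ℤ) ∣ γ 1 1 - 1 := by
  rw [Gamma_mem]
  have h1 : ∀ a : ℤ, ((a : ZMod N) = 1 ↔ (N : ℤ) ∣ a - 1) := fun a ↦ by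
    rw [← Int.cast_one, eq_comm, ZMod.intCast_eq_intCast_iff_dvd_sub]
  have h0 : ∀ a : ℤ, ((a : ZMod N) = 0 ↔ (N : ℤ) ∣ a) := fun a ↦ ZMod.intCast_zmod_eq_zero_iff_dvd a N
  rw [h1, h0, h0, h1]

/-- `Γ(t^b) ≤ Γ(t^a)` for `a ≤ b`. [folklore] -/
theorem Gamma_pow_le (t : ℕ) {a b : ℕ} (hab : a ≤ b) : Gamma (t ^ b) ≤ Gamma (t ^ a) := by
  intro γ hγ
  rw [mem_Gamma_iff_dvd] at hγ ⊢
  have hd : ((t ^ a : ℕ) : ℤ) ∣ ((t ^ b : ℕ) : ℤ) := by exact_mod_cast pow_dvd_pow t hab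
  exact ⟨hd.trans hγ.1, hd.trans hγ.2.1, hd.trans hγ.2.2.1, hd.trans hγ.2.2.2⟩

variable (t : ℕ)

/-- **Depth of a shift**: if `Y` is the `t^a`-shift of `X` (`Y = diag(t^a,1) X diag(t^a,1)⁻¹` on entries) and
`X ∈ Γ(t^M)`, `a ≤ M`, then `Y ∈ Γ(t^{M−a})`. [folklore] -/
theorem mem_Gamma_of_shiftRel (ht : t ≠ 0) {a M : ℕ} (haM : a ≤ M) {X Y : SL(2, ℤ)}
    (hR : Y 0 0 = X 0 0 ∧ Y 0 1 = (t : ℤ) ^ a * X 0 1 ∧ (t : ℤ) ^ a * Y 1 0 = X 1 0 ∧ Y 1 1 = X 1 1)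
    (hX : X ∈ Gamma (t ^ M)) : Y ∈ Gamma (t ^ (M - a)) := by
  obtain ⟨h1, h2, h3, h4⟩ := hR
  rw [mem_Gamma_iff_dvd] at hX ⊢
  obtain ⟨d1, d2, d3, d4⟩ := hX
  have hpow : ((t ^ M : ℕ) : ℤ) = (t : ℤ) ^ a * (t : ℤ) ^ (M - a) := by
    rw [← pow_add, Nat.add_sub_cancel' haM]; push_cast; ring
  have hta : ((t : ℤ) ^ a) ≠ 0 := pow_ne_zero a (by exact_mod_cast ht)
  have hdvd : ((t ^ (M - a) : ℕ) : ℤ) ∣ ((t ^ M : ℕ) : ℤ) := by exact_mod_cast pow_dvd_pow t (Nat.sub_le M a)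
  refine ⟨by rw [h1]; exact hdvd.trans d1, by rw [h2]; exact (hdvd.trans d2).mul_left _, ?_, by rw [h4]; exact hdvd.trans d4⟩
  rw [← h3, hpow] at d3
  push_cast
  exact (mul_dvd_mul_iff_left hta).mp d3

/-- **Depth of an inverse shift**: if `Y` is the `t^a`-shift of `X` and `Y ∈ Γ(t^M)`, `a ≤ M`, then `X ∈ Γ(t^{M−a})`.
[folklore] -/
theorem mem_Gamma_of_shiftRel' (ht : t ≠ 0) {a M : ℕ} (haM : a ≤ M) {X Y : SL(2, ℤ)}
    (hR : Y 0 0 = X 0 0 ∧ Y 0 1 = (t : ℤ) ^ a * X 0 1 ∧ (t : ℤ) ^ a * Y 1 0 = X 1 0 ∧ Y 1 1 = X 1 1)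
    (hY : Y ∈ Gamma (t ^ M)) : X ∈ Gamma (t ^ (M - a)) := by
  obtain ⟨h1, h2, h3, h4⟩ := hR
  rw [mem_Gamma_iff_dvd] at hY ⊢
  obtain ⟨d1, d2, d3, d4⟩ := hY
  have hpow : ((t ^ M : ℕ) : ℤ) = (t : ℤ) ^ a * (t : ℤ) ^ (M - a) := by
    rw [← pow_add, Nat.add_sub_cancel' haM]; push_cast; ring
  have hta : ((t : ℤ) ^ a) ≠ 0 := pow_ne_zero a (by exact_mod_cast ht)
  have hdvd : ((t ^ (M - a) : ℕ) : ℤ) ∣ ((t ^ M : ℕ) : ℤ) := by exact_mod_cast pow_dvd_pow t (Nat.sub_le M a)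
  refine ⟨by rw [← h1]; exact hdvd.trans d1, ?_, by rw [← h3]; exact (hdvd.trans d3).mul_left _, by rw [← h4]; exact hdvd.trans d4⟩
  rw [h2, hpow] at d2
  push_cast
  exact (mul_dvd_mul_iff_left hta).mp d2

/-- **Shifting down** by `d`: if `d ∣ b` then `γ = (a b; c e)` is the `d`-shift of `(a, b/d; dc, e) ∈ SL₂(ℤ)`. [folklore] -/
theorem exists_shiftRel_down {d : ℤ} (γ : SL(2, ℤ)) (h : d ∣ γ 0 1) :
    ∃ X : SL(2, ℤ), γ 0 0 = X 0 0 ∧ γ 0 1 = d * X 0 1 ∧ d * γ 1 0 = X 1 0 ∧ γ 1 1 = X 1 1 := by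
  obtain ⟨b', hb'⟩ := h
  have hdet := det_entries γ
  refine ⟨⟨!![γ 0 0, b'; d * γ 1 0, γ 1 1], ?_⟩, rfl, ?_, rfl, rfl⟩
  · rw [Matrix.det_fin_two_of]
    rw [hb'] at hdet
    linear_combination hdet
  · exact hb'

/-- **Shifting up** by `d`: if `d ∣ c` then `(a, db; c/d, e) ∈ SL₂(ℤ)` is the `d`-shift of `γ = (a b; c e)`. [folklore] -/
theorem exists_shiftRel_up {d : ℤ} (γ : SL(2, ℤ)) (h : d ∣ γ 1 0) :
    ∃ Y : SL(2, ℤ), Y 0 0 = γ 0 0 ∧ Y 0 1 = d * γ 0 1 ∧ d * Y 1 0 = γ 1 0 ∧ Y 1 1 = γ 1 1 := by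
  obtain ⟨c', hc'⟩ := h
  have hdet := det_entries γ
  refine ⟨⟨!![γ 0 0, d * γ 0 1; c', γ 1 1], ?_⟩, rfl, rfl, ?_, rfl⟩
  · rw [Matrix.det_fin_two_of]
    rw [hc'] at hdet
    linear_combination hdet
  · exact hc'.symm

/-- The integer shift relation maps to the shift relation in `SL₂(ℤ[1/t])` under `ι`. [folklore] -/
theorem shiftRel_iota {d : ℤ} {X Y : SL(2, ℤ)}
    (hR : Y 0 0 = X 0 0 ∧ Y 0 1 = d * X 0 1 ∧ d * Y 1 0 = X 1 0 ∧ Y 1 1 = X 1 1) :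
    (ConjSpanGenAllLevels.iota t Y) 0 0 = (ConjSpanGenAllLevels.iota t X) 0 0 ∧
      (ConjSpanGenAllLevels.iota t Y) 0 1 = (d : Away t) * (ConjSpanGenAllLevels.iota t X) 0 1 ∧
      (d : Away t) * (ConjSpanGenAllLevels.iota t Y) 1 0 = (ConjSpanGenAllLevels.iota t X) 1 0 ∧
      (ConjSpanGenAllLevels.iota t Y) 1 1 = (ConjSpanGenAllLevels.iota t X) 1 1 := by
  obtain ⟨h1, h2, h3, h4⟩ := hR
  simp only [ConjSpanGenAllLevels.iota_apply]
  refine ⟨by rw [h1], by rw [h2]; push_cast; rfl, by rw [← h3]; push_cast; rfl, by rw [h4]⟩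

/-- The integer `tⁿ`-shift relation under `ι`, with the scalar written `(t : ℤ[1/t])ⁿ`. [folklore] -/
theorem shiftRel_iota_pow (n : ℕ) {X Y : SL(2, ℤ)}
    (hR : Y 0 0 = X 0 0 ∧ Y 0 1 = (t : ℤ) ^ n * X 0 1 ∧ (t : ℤ) ^ n * Y 1 0 = X 1 0 ∧ Y 1 1 = X 1 1) :
    (ConjSpanGenAllLevels.iota t Y) 0 0 = (ConjSpanGenAllLevels.iota t X) 0 0 ∧
      (ConjSpanGenAllLevels.iota t Y) 0 1 = (t : Away t) ^ n * (ConjSpanGenAllLevels.iota t X) 0 1 ∧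
      (t : Away t) ^ n * (ConjSpanGenAllLevels.iota t Y) 1 0 = (ConjSpanGenAllLevels.iota t X) 1 0 ∧
      (ConjSpanGenAllLevels.iota t Y) 1 1 = (ConjSpanGenAllLevels.iota t X) 1 1 := by
  have h := shiftRel_iota t hR
  push_cast at h
  exact h

end Depth

/-! ### Shift invariance on entries -/

section ShiftInvariance

variable {t n L : ℕ} {K : Type*} [CommRing K] {u : Gamma0 L → Fin 1 → K}

/-- **`tⁿ`-shift invariance on entries**: `π_{tⁿ}^* u = π_1^* u` on `Γ₀(L tⁿ)` says `u(γ') = u(γ)` whenever `γ' ∈ Γ₀(L)` is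
the `tⁿ`-shift of `γ ∈ Γ₀(L)`. [cite: Shimura1971, §8.3 (8.3.2)] -/
theorem apply_eq_of_shiftInvariant [NeZero t] [NeZero L]
    (hshift : degeneracyPullback 0 L (L * t ^ n) (t ^ n) K dvd_rfl u = degeneracyPullback 0 L (L * t ^ n) 1 K (by simp) u)
    (γ γ' : Gamma0 L)
    (hR : (γ' : SL(2, ℤ)) 0 0 = (γ : SL(2, ℤ)) 0 0 ∧ (γ' : SL(2, ℤ)) 0 1 = (t : ℤ) ^ n * (γ : SL(2, ℤ)) 0 1 ∧
      (t : ℤ) ^ n * (γ' : SL(2, ℤ)) 1 0 = (γ : SL(2, ℤ)) 1 0 ∧ (γ' : SL(2, ℤ)) 1 1 = (γ : SL(2, ℤ)) 1 1) :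
    u γ' = u γ := by
  obtain ⟨h1, h2, h3, h4⟩ := hR
  have hL : (L : ℤ) ∣ (γ' : SL(2, ℤ)) 1 0 := by
    have h := γ'.2
    rw [Gamma0_mem] at h
    exact (ZMod.intCast_zmod_eq_zero_iff_dvd _ L).mp h
  have hmem : (γ : SL(2, ℤ)) ∈ Gamma0 (L * t ^ n) := by
    rw [Gamma0_mem]
    have hd : ((L * t ^ n : ℕ) : ℤ) ∣ (γ : SL(2, ℤ)) 1 0 := by
      rw [← h3]
      push_cast
      rw [mul_comm ((L : ℤ))]
      exact mul_dvd_mul_left _ hL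
    exact (ZMod.intCast_zmod_eq_zero_iff_dvd _ _).mpr hd
  have h := congrFun hshift ⟨γ, hmem⟩
  rw [degeneracyPullback_zero_apply, degeneracyPullback_zero_apply] at h
  have htn : ((t : ℤ) ^ n) ≠ 0 := pow_ne_zero n (by exact_mod_cast NeZero.ne t)
  have e1 : Gamma0.degeneracyConj L (L * t ^ n) (t ^ n) dvd_rfl ⟨γ, hmem⟩ = γ' := by
    apply Subtype.ext
    ext i j
    rw [Gamma0.degeneracyConj_apply]
    fin_cases i <;> fin_cases j
    · exact h1.symm
    · show ((t ^ n : ℕ) : ℤ) * (γ : SL(2, ℤ)) 0 1 = (γ' : SL(2, ℤ)) 0 1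
      rw [h2]; push_cast; rfl
    · show (γ : SL(2, ℤ)) 1 0 / ((t ^ n : ℕ) : ℤ) = (γ' : SL(2, ℤ)) 1 0
      rw [← h3]; push_cast
      exact Int.mul_ediv_cancel_left _ htn
    · exact h4.symm
  have e2 : Gamma0.degeneracyConj L (L * t ^ n) 1 (by simp) ⟨γ, hmem⟩ = γ :=
    Subtype.ext (Gamma0.coe_degeneracyConj_one _ _)
  rw [e1, e2] at h
  exact h

end ShiftInvariance

/-! ### Conjugation by `diag(t, t⁻¹)` is the `t²`-shift -/

section DiagP

variable (t : ℕ)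

/-- `tᵉ` is a unit of `ℤ[1/t]` as an integer cast. [folklore] -/
theorem isUnit_intCast_pow (e : ℕ) : IsUnit (((t : ℤ) ^ e : ℤ) : Away t) := by
  have h := isUnit_natCast_pow (p := t) e
  push_cast
  exact_mod_cast h

/-- **`diag(t,t⁻¹) X diag(t,t⁻¹)⁻¹` is the `t²`-shift of `X`.** [folklore] -/
theorem shiftRel_diagP_conj (X : SL(2, Away t)) :
    (diagP t * X * (diagP t)⁻¹) 0 0 = X 0 0 ∧ (diagP t * X * (diagP t)⁻¹) 0 1 = (t : Away t) ^ 2 * X 0 1 ∧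
      (t : Away t) ^ 2 * (diagP t * X * (diagP t)⁻¹) 1 0 = X 1 0 ∧ (diagP t * X * (diagP t)⁻¹) 1 1 = X 1 1 := by
  set T : Away t := algebraMap ℤ (Away t) (t : ℤ) with hT
  set T' : Away t := IsLocalization.Away.invSelf (t : ℤ) with hT'
  have hTT' : T * T' = 1 := IsLocalization.Away.mul_invSelf (S := Away t) (t : ℤ)
  have hTt : T = (t : Away t) := by rw [hT, map_natCast]
  have hP : ((diagP t : SL(2, Away t)) : Matrix (Fin 2) (Fin 2) (Away t)) = !![T, 0; 0, T'] := rfl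
  rw [← hTt]
  simp only [coe_mul, coe_inv, hP, Matrix.adjugate_fin_two, Matrix.mul_apply, Fin.sum_univ_two, Matrix.of_apply,
    Matrix.cons_val', Matrix.cons_val_zero, Matrix.cons_val_one, Matrix.empty_val', Matrix.cons_val_fin_one]
  refine ⟨?_, ?_, ?_, ?_⟩
  · linear_combination (X 0 0) * hTT'
  · ring
  · linear_combination (X 1 0) * (T * T' + 1) * hTT'
  · linear_combination (X 1 1) * hTT'

/-- **`diag(t,t⁻¹)^m X diag(t,t⁻¹)^{-m}` is the `t^{2m}`-shift of `X`.** [folklore] -/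
theorem shiftRel_diagP_pow_conj (X : SL(2, Away t)) (m : ℕ) :
    (diagP t ^ m * X * (diagP t ^ m)⁻¹) 0 0 = X 0 0 ∧
      (diagP t ^ m * X * (diagP t ^ m)⁻¹) 0 1 = (t : Away t) ^ (2 * m) * X 0 1 ∧
      (t : Away t) ^ (2 * m) * (diagP t ^ m * X * (diagP t ^ m)⁻¹) 1 0 = X 1 0 ∧
      (diagP t ^ m * X * (diagP t ^ m)⁻¹) 1 1 = X 1 1 := by
  induction m with
  | zero => simp
  | succ m ih =>
    have hstep := shiftRel_diagP_conj t (diagP t ^ m * X * (diagP t ^ m)⁻¹)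
    have h := shiftRel_trans (s₁ := (t : Away t) ^ (2 * m)) (s₂ := (t : Away t) ^ 2) ih hstep
    have heq : diagP t * (diagP t ^ m * X * (diagP t ^ m)⁻¹) * (diagP t)⁻¹ =
        diagP t ^ (m + 1) * X * (diagP t ^ (m + 1))⁻¹ := by
      rw [pow_succ']; group
    have hpow : (t : Away t) ^ (2 * m) * (t : Away t) ^ 2 = (t : Away t) ^ (2 * (m + 1)) := by ring
    rw [heq, hpow] at h
    exact h

/-- `diag(t, t⁻¹) ∈ Δ_t(L′)`. [folklore] -/
theorem diagP_mem_Delta (L' : ℕ) : diagP t ∈ Delta t L' :=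
  ⟨0, by simp [diagP]⟩

end DiagP

end Summit.BirchSwinnertonDyer.BirchSwinnertonDyer.Theorems.ManinLocalTwoThree
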